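import Literature.NumberTheory.DiophantineGeometry.AVIsogenyFlat
import Literature.NumberTheory.DiophantineGeometry.AVKernelHopf
import Literature.AlgebraicGeometry.Motives.TateAbelianFiniteLatticeProofs
import Literature.AlgebraicGeometry.Motives.AbelianVarietyTorsionProofs
import HarnessLib

/-!
# Flipping an isogeny pair of abelian varieties: `v ∘ u = [m]` from `B` gives `u' : A → B` finite flat with `v' ∘ u' = [n]`, equivariantly

Family `motives`, layer `Literature/AlgebraicGeometry/Motives`; theorems only (no definition, no
named fact). In characteristic `0` (more generally when the integers involved are invertible in
`K`), an "isogeny pair" recorded in ONE orientation — homomorphisms `u : B → A`, `v : A → B` of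
abelian varieties of the same dimension with `v ∘ u = [m]_B`, `m ≥ 1` — can be FLIPPED: there are
`u' : A → B` finite flat (indeed an isogeny) and `v' : B → A` with `v' ∘ u' = [n]_A`,
`u' ∘ v' = [n]_B`, `n ≥ 1`; and if `v` intertwines endomorphisms `φ` of `A` and `ψ` of `B`
(`v ≫ ψ = φ ≫ v`), then so do `u'` (`u' ≫ ψ = φ ≫ u'`) and `v'` (`v' ≫ φ = ψ ≫ v'`). This is the
classical symmetry of isogeny (Mumford, *Abelian Varieties*, §19, Remark p. 169: an isogeny `f` of
degree `n` has `g` with `g ∘ f = [n]`, `f ∘ g = [n]`; Milne, *Abelian Varieties*, §8: isogenies are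
finite flat and `Hom(A, B)` is torsion free), assembled from the tree's PROVED isogeny theory:

* `u` is an isogeny (`isIsogeny_of_comp_eq_nsmul_id`): finite because `v ∘ u = [m]` is finite and
  `v` is separated (Mathlib `IsFinite.of_comp`), surjective because finite and equidimensional
  (`IsIsogeny.of_isFinite`, Görtz–Wedhorn II, Cor. 27.177);
* its quasi-inverse `τ : A → B`, `τ ∘ u = [n]_B`, `u ∘ τ = [n]_A`
  (`IsIsogeny.exists_nsmul_inverse_holds`, Mumford §19 Remark p. 169), is an isogeny
  (`isIsogeny_of_comp_eq_of_comp_eq`), hence FLAT (`IsIsogeny.flat`, Görtz–Wedhorn II,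
  Prop. 27.54);
* equivariance transfers along the pair because isogenies, in particular `[m]`, are epimorphisms
  of abelian varieties (`IsIsogeny.cancel_left`, Görtz–Wedhorn II, Prop. 27.178): `u ≫ (m • τ) =
  u ≫ (n • v)` gives `m • τ = n • v`, so `m • (τ ≫ ψ) = m • (φ ≫ τ)` and `τ ≫ ψ = φ ≫ τ`
  (cancel `[m]_A`); then `τ ≫ (u ≫ φ) = n • φ = τ ≫ (ψ ≫ u)` and `u ≫ φ = ψ ≫ u` (cancel `τ`).

Consumer: the reach clause of Deligne's Weil family (`HodgeTheory/WeilFamilyReach`,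
`HodgeTheory/WeilFamilyReachSystem`), where the `K`-isogeny between a hyperbolic `(A, φ)` and the
reached fibre `(Y_s, Ψ_s)` is recorded from the fibre in one fact and to the fibre in the other
(`HodgeTheory/WeilFamilyReachOfSystem`).

## References

* [MumfordAV1970] D. Mumford, Abelian Varieties (1970), §19, Remark p. 169.
* [Milne1986AbelianVarieties] J. S. Milne, Abelian Varieties, in: Arithmetic Geometry
  (Cornell–Silverman, eds.), Springer 1986, §8 (Prop. 8.1, 8.5).
* [GortzWedhorn2023] U. Görtz, T. Wedhorn, Algebraic Geometry II (2023), Prop. 27.54, Cor. 27.177,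
  Prop. 27.178, Prop. 27.190.
-/

noncomputable section

open CategoryTheory AlgebraicGeometry

universe u

namespace Literature.AlgebraicGeometry.Motives

namespace AbelianVariety

variable {K : Type u} [Field K] {A B : AbelianVariety K}

/-- **Half an isogeny pair is an isogeny**: if `u ≫ v = m • 𝟙 B` with `m` invertible in `K` and
`dim B = dim A`, then `u : B → A` is an isogeny — finite since `[m]_B = v ∘ u` is finite and `v` is
separated (Mathlib `IsFinite.of_comp`), and then surjective since `dim B = dim A`
(`IsIsogeny.of_isFinite`). [cite: GortzWedhorn2023, Cor. 27.177 (2)]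
[cite: MumfordAV1970, §19 Remark p. 169] -/
theorem isIsogeny_of_comp_eq_nsmul_id {u : B ⟶ A} {v : A ⟶ B} {m : ℕ} (hm : (m : K) ≠ 0)
    (huv : u ≫ v = m • 𝟙 B) (hdim : B.dim = A.dim) : IsIsogeny u := by
  have hfin : IsFinite (Hom.toSchemeHom u ≫ Hom.toSchemeHom v) := by
    rw [← toSchemeHom_comp, huv]
    exact (isIsogeny_nsmul_id_of_cast_ne_zero B m hm).2
  have hsep : IsSeparated (Hom.toSchemeHom v) := by
    have : IsSeparated (Hom.toSchemeHom v ≫ B.X.hom) := by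
      rw [toSchemeHom_comp_hom]
      infer_instance
    exact IsSeparated.of_comp (Hom.toSchemeHom v) B.X.hom
  haveI : IsFinite (Hom.toSchemeHom u) := IsFinite.of_comp (Hom.toSchemeHom u) (Hom.toSchemeHom v)
  exact IsIsogeny.of_isFinite u hdim

/-- **Torsion-freeness of `Hom`, in the form used here**: `m • f = m • g → f = g` for `m`
invertible in `K` (`m • f = [m]_A ≫ f` and `[m]_A` is an isogeny, hence an epimorphism of abelian
varieties). [cite: GortzWedhorn2023, Prop. 27.178 (1) and Prop. 27.187]
[cite: MumfordAV1970, §19 Thm. 3 (Hom is torsion free)] -/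
theorem eq_of_nsmul_eq_nsmul {f g : A ⟶ B} {m : ℕ} (hm : (m : K) ≠ 0) (h : m • f = m • g) :
    f = g := by
  refine (isIsogeny_nsmul_id_of_cast_ne_zero A m hm).cancel_left ?_
  rwa [Preadditive.nsmul_comp, Preadditive.nsmul_comp, Category.id_comp]

/-- **Flipping an isogeny pair, equivariantly** (characteristic `0`). Let `u : B → A`, `v : A → B`
be homomorphisms of abelian varieties of the same dimension over a field of characteristic `0`
with `u ≫ v = m • 𝟙 B` (`v ∘ u = [m]_B`), `m ≥ 1`, and let `v` intertwine `φ ∈ End A` and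
`ψ ∈ End B` (`v ≫ ψ = φ ≫ v`). Then there are `u' : A → B` and `v' : B → A`, both isogenies, `u'`
(finite) FLAT, and `n ≥ 1` with `u' ≫ v' = n • 𝟙 A`, `v' ≫ u' = n • 𝟙 B`, `v' ≫ φ = ψ ≫ v'` and
`u' ≫ ψ = φ ≫ u'`. Proof (module docstring): `u` is an isogeny; take `v' := u` and `u' := τ` its
quasi-inverse (Mumford §19 Remark p. 169), an isogeny and so flat (Görtz–Wedhorn II, 27.54); the
equivariance of `τ` and `u` follows from that of `v` by cancelling the epimorphisms `u`, `[m]_A`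
and `τ`. [cite: MumfordAV1970, §19 Remark p. 169] [cite: Milne1986AbelianVarieties, §8 Prop. 8.1]
[cite: GortzWedhorn2023, Prop. 27.54, Prop. 27.178 and Prop. 27.190] -/
theorem exists_isogenyPair_flip [CharZero K] {u : B ⟶ A} {v : A ⟶ B} {m : ℕ} (hm : 0 < m)
    (huv : u ≫ v = m • 𝟙 B) (hdim : B.dim = A.dim) {φ : A ⟶ A} {ψ : B ⟶ B}
    (hv : v ≫ ψ = φ ≫ v) :
    ∃ (u' : A ⟶ B) (v' : B ⟶ A) (n : ℕ), 0 < n ∧ u' ≫ v' = n • 𝟙 A ∧ v' ≫ u' = n • 𝟙 B ∧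
      IsIsogeny u' ∧ IsIsogeny v' ∧ Flat (Hom.toSchemeHom u') ∧
      v' ≫ φ = ψ ≫ v' ∧ u' ≫ ψ = φ ≫ u' := by
  have hmK : (m : K) ≠ 0 := Nat.cast_ne_zero.2 hm.ne'
  have hu : IsIsogeny u := isIsogeny_of_comp_eq_nsmul_id hmK huv hdim
  obtain ⟨τ, n, hn, huτ, hτu⟩ := IsIsogeny.exists_nsmul_inverse_holds hu
  have hnK : (n : K) ≠ 0 := Nat.cast_ne_zero.2 hn.ne'
  have hτ : IsIsogeny τ :=
    isIsogeny_of_comp_eq_of_comp_eq (isIsogeny_nsmul_id_of_cast_ne_zero B n hnK)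
      (isIsogeny_nsmul_id_of_cast_ne_zero A n hnK) huτ hτu
  -- `m • τ = n • v`: both are hit by `u` onto `(m n) • 𝟙 B`, and `u` is an epimorphism
  have hτv : m • τ = n • v := by
    refine hu.cancel_left ?_
    rw [Preadditive.comp_nsmul, Preadditive.comp_nsmul, huτ, huv, smul_smul, smul_smul, mul_comm]
  -- `τ` is equivariant: `m • (τ ≫ ψ) = m • (φ ≫ τ)` from the equivariance of `v`
  have hτψ : τ ≫ ψ = φ ≫ τ := by
    refine eq_of_nsmul_eq_nsmul hmK ?_
    rw [← Preadditive.nsmul_comp, ← Preadditive.comp_nsmul, hτv, Preadditive.nsmul_comp,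
      Preadditive.comp_nsmul, hv]
  -- `u` is equivariant: `τ ≫ (u ≫ φ) = n • φ = τ ≫ (ψ ≫ u)`, and `τ` is an epimorphism
  have huφ : u ≫ φ = ψ ≫ u := by
    refine hτ.cancel_left ?_
    rw [← Category.assoc, hτu, ← Category.assoc, hτψ, Category.assoc, hτu, Preadditive.nsmul_comp,
      Preadditive.comp_nsmul, Category.id_comp, Category.comp_id]
  exact ⟨τ, u, n, hn, hτu, huτ, hτ, hu, hτ.flat, huφ, hτψ⟩

/-- The flip without endomorphisms: from `u ≫ v = m • 𝟙 B`, `m ≥ 1`, `dim B = dim A`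
(characteristic `0`) to an isogeny pair `u' : A → B` flat, `v' : B → A`, `u' ≫ v' = n • 𝟙 A`,
`v' ≫ u' = n • 𝟙 B`, `n ≥ 1`. [cite: MumfordAV1970, §19 Remark p. 169]
[cite: GortzWedhorn2023, Prop. 27.54 and Prop. 27.190] -/
theorem exists_isogenyPair_flip' [CharZero K] {u : B ⟶ A} {v : A ⟶ B} {m : ℕ} (hm : 0 < m)
    (huv : u ≫ v = m • 𝟙 B) (hdim : B.dim = A.dim) :
    ∃ (u' : A ⟶ B) (v' : B ⟶ A) (n : ℕ), 0 < n ∧ u' ≫ v' = n • 𝟙 A ∧ v' ≫ u' = n • 𝟙 B ∧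
      IsIsogeny u' ∧ IsIsogeny v' ∧ Flat (Hom.toSchemeHom u') := by
  obtain ⟨u', v', n, hn, h₁, h₂, hu', hv', hfl, -, -⟩ :=
    exists_isogenyPair_flip (φ := 𝟙 A) (ψ := 𝟙 B) hm huv hdim
      (by rw [Category.comp_id, Category.id_comp])
  exact ⟨u', v', n, hn, h₁, h₂, hu', hv', hfl⟩

end AbelianVariety

end Literature.AlgebraicGeometry.Motives

end
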